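import Summits.ValiantsHypothesis.ValiantsHypothesis.Theorems.KPlusLogSqLawTropicalSymmetricOrbitThreeFourSeventeen

/-!
# Route «KPlusLogSqLaw» — the symmetric `(3,4)` tropical row in the ORBIT model: FLOOR `16` and the kernel window `[16, 17]`

HONEST FRAMING.  Helper file (seat val-sym-lift-p2 (g6), cell `pub-symmetroid`, 2026-08-27; `--supports` the `WeakLifting` item
stmt-ValiantsHypothesis-19561 as a helper, no closure claim).  SMALL-FORMAT, one explicit tropical design: the tropicalisation of the cell's
pencil of record T2-TROP16 on the support `d = (0,1,4,40)` (theory-2, `HOME/pub-symmetroid-theory-2/rows/trop/T2-TROP16-3-4-0-1-4-40-b24_pencil.json`: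
valuations `v = −60·val`, signs from `sgnbits`, all twenty-four incidences present) carries a chain of SEVENTEEN orbit-dominant terms at the
integer slopes `−1200 < −1110 < ⋯ < 420` (scale `60`) with alternating signs — `16` alternations, six of the seventeen terms being PAIR CARRIERS
(3-cycles), which is why the single-term row stops at `15` (p493335) while the orbit row reaches `16`.  Hence `¬ TropRootLawAtSymmOrb 3 4 15` and,
with `tropRootLawAtSymmOrb_three_four_seventeen` (p502374), the KERNEL WINDOW `[16, 17]` for the orbit row (cell value `16`, two codes; whether
`17` is attained is not decided here; `TSymOrb34Le16` stays a target, NOT asserted).  A tropical row bounds no real pencil by itself; nothing here is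
about `TropicalB` / `WeakLifting` in their windows, Conjecture B, DoorA34 = `PosRootLawAt 3 4 18` (OPEN, never asserted), `MatrixDescartes`
(stmt-ValiantsHypothesis-18050) or VP ≠ VNP.

PROOF.  A dual certificate for ORBIT dominance (`isOrbitDominant_of_scaledPotential`, `m = 3`: symmetric potentials tight on the cells of the
term and of its transpose, strictly slack on every other present incidence; the all-tight terms are the term and its transpose by
`orbit_escape`), then `decide` on the explicit integer data (scale `S = 2`), strict monotonicity of the slopes and alternation of `termSign`.
The chain in the cell's letters (`T_k(a;b)` transposition fixing `k`, `C(c₀₁,c₀₂,c₁₂)` pair carrier, `D(λ₀λ₁λ₂)` identity):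
`T₀(0;0)⁻ T₀(1;0)⁺ C(1,1,0)⁻ T₂(1;1)⁺ T₀(2;0)⁻ C(1,2,0)⁺ C(2,2,0)⁻ T₂(1;2)⁺ T₂(2;2)⁻ T₀(3;0)⁺ C(2,3,0)⁻ C(2,3,1)⁺ C(2,3,2)⁻ T₁(0;3)⁺ T₁(1;3)⁻ T₁(2;3)⁺ T₁(3;3)⁻`.
[design: theory-2 T2-TROP16 (2026-08-23); orbit-model chain, integer slopes and potentials by this seat's exact scripts
`HOME/val-sym-lift-p2/g6/exp/orbfloor/` (trop16.py, cert16.py, gen_lean.py); folklore-level LP-duality certificate, no citation exists]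
-/

set_option linter.dupNamespace false
set_option autoImplicit false

namespace Summit.ValiantsHypothesis.ValiantsHypothesis.Theorems.KPlusLogSqLaw

open Summit.ValiantsHypothesis.ValiantsHypothesis.Theorems.MatrixDescartes.Negative
open Summit.ValiantsHypothesis.ValiantsHypothesis.Theorems.LacunarySymmetroidMatrixDescartes
open Summit.ValiantsHypothesis.ValiantsHypothesis.Theorems.LacunarySymmetroidMatrixDescartes.TropicalCensus
open Summit.ValiantsHypothesis.ValiantsHypothesis.Theorems.LacunarySymmetroidMatrixDescartes.TropicalCensus.Orbit
open Finset

namespace SymmetricOrbitThreeFourFloor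

/-- two fixed-point-free permutations of `Fin 3` that agree columnwise with `σ` or `σ⁻¹` are `σ` or `σ⁻¹`. -/
theorem fpf_columnwise : ∀ σ τ : Equiv.Perm (Fin 3), (∀ i, σ i ≠ i) → (∀ i, τ i = σ i ∨ τ i = σ⁻¹ i) → τ = σ ∨ τ = σ⁻¹ := by
  decide

/-- a fixed-point-free permutation of `Fin 3` differs from its inverse at every point. -/
theorem fpf_ne_inv : ∀ σ : Equiv.Perm (Fin 3), (∀ i, σ i ≠ i) → ∀ i, σ i ≠ σ⁻¹ i := by decide

/-- **`orbit_escape`** (`m = 3`).  For a term `(σ, μ)` that is an identity / cycle-constant involution or a 3-cycle, a term all of whose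
columns coincide (cell and letter) with a column of `(σ, μ)` or of its transpose IS `(σ, μ)` or its transpose. [elementary] -/
theorem orbit_escape {K : ℕ} (σ : Equiv.Perm (Fin 3)) (μ : Fin 3 → Fin K)
    (hshape : (∀ i, σ (σ i) = i ∧ μ (σ i) = μ i) ∨ (∀ i, σ i ≠ i))
    (p' : Equiv.Perm (Fin 3) × (Fin 3 → Fin K))
    (hall : ∀ i, (p'.1 i = σ i ∧ p'.2 i = μ i) ∨ (p'.1 i = σ⁻¹ i ∧ p'.2 i = μ (σ⁻¹ i))) :
    p' = (σ, μ) ∨ p' = transposeTerm (σ, μ) := by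
  rcases hshape with hinv | hfpf
  · -- involution with constant letters on its cycles: both options say the same
    have hσ : ∀ i, σ⁻¹ i = σ i := fun i => by
      rw [Equiv.Perm.inv_def, Equiv.symm_apply_eq]; exact (hinv i).1.symm
    left
    refine Prod.ext (Equiv.ext fun i => ?_) (funext fun i => ?_)
    · rcases hall i with ⟨h, -⟩ | ⟨h, -⟩
      · exact h
      · rw [h, hσ]
    · rcases hall i with ⟨-, h⟩ | ⟨-, h⟩
      · exact h
      · rw [h, hσ, (hinv i).2]
  · have hτ : ∀ i, p'.1 i = σ i ∨ p'.1 i = σ⁻¹ i := fun i => by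
      rcases hall i with ⟨h, -⟩ | ⟨h, -⟩
      · exact Or.inl h
      · exact Or.inr h
    rcases fpf_columnwise σ p'.1 hfpf hτ with h | h
    · left
      refine Prod.ext h (funext fun i => ?_)
      rcases hall i with ⟨-, h2⟩ | ⟨h1, -⟩
      · exact h2
      · exact absurd (h ▸ h1 : σ i = σ⁻¹ i) (fpf_ne_inv σ hfpf i)
    · right
      unfold transposeTerm
      refine Prod.ext h (funext fun i => ?_)
      rcases hall i with ⟨h1, -⟩ | ⟨-, h2⟩
      · exact absurd ((h ▸ h1 : σ⁻¹ i = σ i).symm) (fpf_ne_inv σ hfpf i)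
      · exact h2

/-- **Dual certificate for ORBIT dominance** (`m = 3`, scaled by a positive integer `S`).  If potentials `u, w` are tight on the cells of
`(σ, μ)` AND of its transpose and strictly slack on every other present incidence, and `(σ, μ)` is an identity / cycle-constant involution or
a 3-cycle term, then `(σ, μ)` is orbit-dominant at slope `θ`. [folklore: LP duality; the orbit twin of `isDominant_of_scaledPotential`] -/
theorem isOrbitDominant_of_scaledPotential {K : ℕ} (d : Fin K → ℕ) (v ε : Fin 3 → Fin 3 → Fin K → ℤ) (θ : ℤ)
    (σ : Equiv.Perm (Fin 3)) (μ : Fin 3 → Fin K) (S : ℤ) (hS : 0 < S) (u w : Fin 3 → ℤ)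
    (hshape : (∀ i, σ (σ i) = i ∧ μ (σ i) = μ i) ∨ (∀ i, σ i ≠ i))
    (hpres : ∀ i, ε (σ i) i (μ i) ≠ 0)
    (htight : ∀ i, u (σ i) + w i = S * (θ * (d (μ i) : ℤ) - v (σ i) i (μ i)))
    (htightT : ∀ i, u (σ⁻¹ i) + w i = S * (θ * (d (μ (σ⁻¹ i)) : ℤ) - v (σ⁻¹ i) i (μ (σ⁻¹ i))))
    (hslack : ∀ a b l, ε a b l ≠ 0 → ¬ (σ b = a ∧ μ b = l) → ¬ (σ⁻¹ b = a ∧ μ (σ⁻¹ b) = l) →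
      S * (θ * (d l : ℤ) - v a b l) < u a + w b) :
    IsOrbitDominant d v ε θ (σ, μ) := by
  constructor
  · unfold termSign
    refine mul_ne_zero ?_ ?_
    · exact Units.ne_zero _
    · rw [Finset.prod_ne_zero_iff]
      intro i _
      exact hpres i
  · intro p' hne hneT hp'
    rw [tropWeight_eq_sum, tropWeight_eq_sum]
    have hle : ∀ i, S * (θ * (d (p'.2 i) : ℤ) - v (p'.1 i) i (p'.2 i)) ≤ u (p'.1 i) + w i := by
      intro i
      by_cases hc : p'.1 i = σ i ∧ p'.2 i = μ i
      · rw [hc.1, hc.2, htight]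
      · by_cases hc' : p'.1 i = σ⁻¹ i ∧ p'.2 i = μ (σ⁻¹ i)
        · rw [hc'.1, hc'.2, htightT]
        · exact le_of_lt (hslack _ _ _ (present_of_termSign_ne_zero ε p' hp' i)
            (fun h => hc ⟨h.1.symm, h.2.symm⟩) (fun h => hc' ⟨h.1.symm, h.2.symm⟩))
    have hex : ∃ i, ¬ (p'.1 i = σ i ∧ p'.2 i = μ i) ∧ ¬ (p'.1 i = σ⁻¹ i ∧ p'.2 i = μ (σ⁻¹ i)) := by
      by_contra hcon
      push Not at hcon
      have hall : ∀ i, (p'.1 i = σ i ∧ p'.2 i = μ i) ∨ (p'.1 i = σ⁻¹ i ∧ p'.2 i = μ (σ⁻¹ i)) := fun i => by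
        by_cases hA : p'.1 i = σ i ∧ p'.2 i = μ i
        · exact Or.inl hA
        · exact Or.inr (hcon i fun h1 h2 => hA ⟨h1, h2⟩)
      rcases orbit_escape σ μ hshape p' hall with h | h
      · exact hne h
      · exact hneT h
    obtain ⟨i0, hi0, hi0'⟩ := hex
    have hlt0 : S * (θ * (d (p'.2 i0) : ℤ) - v (p'.1 i0) i0 (p'.2 i0)) < u (p'.1 i0) + w i0 :=
      hslack _ _ _ (present_of_termSign_ne_zero ε p' hp' i0) (fun h => hi0 ⟨h.1.symm, h.2.symm⟩)
        (fun h => hi0' ⟨h.1.symm, h.2.symm⟩)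
    have hperm : ∀ τ : Equiv.Perm (Fin 3), ∑ i, (u (τ i) + w i) = ∑ a, u a + ∑ i, w i := by
      intro τ
      rw [Finset.sum_add_distrib]
      congr 1
      exact Equiv.sum_comp τ u
    have hsum : S * ∑ i, (θ * (d (p'.2 i) : ℤ) - v (p'.1 i) i (p'.2 i)) <
        S * ∑ i, (θ * (d (μ i) : ℤ) - v (σ i) i (μ i)) := by
      rw [Finset.mul_sum, Finset.mul_sum]
      calc ∑ i, S * (θ * (d (p'.2 i) : ℤ) - v (p'.1 i) i (p'.2 i)) < ∑ i, (u (p'.1 i) + w i) :=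
            Finset.sum_lt_sum (fun i _ => hle i) ⟨i0, Finset.mem_univ _, hlt0⟩
        _ = ∑ a, u a + ∑ i, w i := hperm p'.1
        _ = ∑ i, (u (σ i) + w i) := (hperm σ).symm
        _ = ∑ i, S * (θ * (d (μ i) : ℤ) - v (σ i) i (μ i)) := Finset.sum_congr rfl fun i _ => htight i
    exact lt_of_mul_lt_mul_left hsum hS.le

/-- **The design.**  On the support `d = (0,1,4,40)`: the tropicalisation of T2-TROP16 (scale `60`), a SYMMETRIC `3 × 3` four-class design with
signs in `{−1, 1}`, and a chain of seventeen ORBIT-dominant terms at strictly increasing integer slopes with alternating signs (`16` alternations).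
[theory-2 T2-TROP16 + this seat's integer certificate; kernel check by `decide` through `isOrbitDominant_of_scaledPotential`] -/
theorem exists_orbit_chain :
    ∃ (v ε : Fin 3 → Fin 3 → Fin 4 → ℤ) (θ : Fin 17 → ℤ) (p : Fin 17 → Equiv.Perm (Fin 3) × (Fin 3 → Fin 4)),
      (∀ i j l, v i j l = v j i l) ∧ (∀ i j l, ε i j l = ε j i l) ∧ (∀ i j l, (ε i j l).natAbs ≤ 1) ∧ StrictMono θ ∧
      (∀ k, IsOrbitDominant ![0, 1, 4, 40] v ε (θ k) (p k)) ∧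
      (∀ k : Fin 16, termSign ε (p k.castSucc) * termSign ε (p k.succ) < 0) := by
  let D : Fin 4 → ℕ := ![0, 1, 4, 40]
  let V : Fin 3 → Fin 3 → Fin 4 → ℤ := ![![![(-180 : ℤ), (-1320 : ℤ), (-4380 : ℤ), (-26100 : ℤ)], ![(-13680 : ℤ), (-25140 : ℤ), (-27600 : ℤ), (-13860 : ℤ)], ![(-2880 : ℤ), (-4200 : ℤ), (-7020 : ℤ), (-27300 : ℤ)]],
      ![![(-13680 : ℤ), (-25140 : ℤ), (-27600 : ℤ), (-13860 : ℤ)], ![(-15420 : ℤ), (-15060 : ℤ), (-13920 : ℤ), 0], ![(-26940 : ℤ), (-26700 : ℤ), (-25740 : ℤ), (-13380 : ℤ)]],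
      ![![(-2880 : ℤ), (-4200 : ℤ), (-7020 : ℤ), (-27300 : ℤ)], ![(-26940 : ℤ), (-26700 : ℤ), (-25740 : ℤ), (-13380 : ℤ)], ![(-5940 : ℤ), (-7020 : ℤ), (-8760 : ℤ), (-14100 : ℤ)]]]
  let E : Fin 3 → Fin 3 → Fin 4 → ℤ := ![![![1, (-1 : ℤ), 1, (-1 : ℤ)], ![1, 1, (-1 : ℤ), 1], ![1, (-1 : ℤ), 1, 1]], ![![1, 1, (-1 : ℤ), 1], ![(-1 : ℤ), 1, (-1 : ℤ), 1], ![1, (-1 : ℤ), 1, 1]], ![![1, (-1 : ℤ), 1, 1], ![1, (-1 : ℤ), 1, 1], ![1, (-1 : ℤ), 1, 1]]]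
  let Th : Fin 17 → ℤ := ![(-1200 : ℤ), (-1110 : ℤ), (-1050 : ℤ), (-990 : ℤ), (-900 : ℤ), (-825 : ℤ), (-780 : ℤ), (-600 : ℤ), (-576 : ℤ), (-540 : ℤ), (-420 : ℤ), 300, 330, 340, 375, 384, 420]
  let Sg : Fin 17 → Equiv.Perm (Fin 3) := ![(Equiv.swap (1 : Fin 3) 2 : Equiv.Perm (Fin 3)),
      (Equiv.swap (1 : Fin 3) 2 : Equiv.Perm (Fin 3)),
      (Equiv.swap (0 : Fin 3) 1 * Equiv.swap (1 : Fin 3) 2 : Equiv.Perm (Fin 3)),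
      (Equiv.swap (0 : Fin 3) 1 : Equiv.Perm (Fin 3)),
      (Equiv.swap (1 : Fin 3) 2 : Equiv.Perm (Fin 3)),
      (Equiv.swap (0 : Fin 3) 1 * Equiv.swap (1 : Fin 3) 2 : Equiv.Perm (Fin 3)),
      (Equiv.swap (0 : Fin 3) 1 * Equiv.swap (1 : Fin 3) 2 : Equiv.Perm (Fin 3)),
      (Equiv.swap (0 : Fin 3) 1 : Equiv.Perm (Fin 3)),
      (Equiv.swap (0 : Fin 3) 1 : Equiv.Perm (Fin 3)),
      (Equiv.swap (1 : Fin 3) 2 : Equiv.Perm (Fin 3)),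
      (Equiv.swap (0 : Fin 3) 1 * Equiv.swap (1 : Fin 3) 2 : Equiv.Perm (Fin 3)),
      (Equiv.swap (0 : Fin 3) 1 * Equiv.swap (1 : Fin 3) 2 : Equiv.Perm (Fin 3)),
      (Equiv.swap (0 : Fin 3) 1 * Equiv.swap (1 : Fin 3) 2 : Equiv.Perm (Fin 3)),
      (Equiv.swap (0 : Fin 3) 2 : Equiv.Perm (Fin 3)),
      (Equiv.swap (0 : Fin 3) 2 : Equiv.Perm (Fin 3)),
      (Equiv.swap (0 : Fin 3) 2 : Equiv.Perm (Fin 3)),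
      (Equiv.swap (0 : Fin 3) 2 : Equiv.Perm (Fin 3))]
  let Cl : Fin 17 → Fin 3 → Fin 4 := ![![(0 : Fin 4), (0 : Fin 4), (0 : Fin 4)],
      ![(1 : Fin 4), (0 : Fin 4), (0 : Fin 4)],
      ![(1 : Fin 4), (0 : Fin 4), (1 : Fin 4)],
      ![(1 : Fin 4), (1 : Fin 4), (1 : Fin 4)],
      ![(2 : Fin 4), (0 : Fin 4), (0 : Fin 4)],
      ![(1 : Fin 4), (0 : Fin 4), (2 : Fin 4)],
      ![(2 : Fin 4), (0 : Fin 4), (2 : Fin 4)],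
      ![(2 : Fin 4), (2 : Fin 4), (1 : Fin 4)],
      ![(2 : Fin 4), (2 : Fin 4), (2 : Fin 4)],
      ![(3 : Fin 4), (0 : Fin 4), (0 : Fin 4)],
      ![(2 : Fin 4), (0 : Fin 4), (3 : Fin 4)],
      ![(2 : Fin 4), (1 : Fin 4), (3 : Fin 4)],
      ![(2 : Fin 4), (2 : Fin 4), (3 : Fin 4)],
      ![(3 : Fin 4), (0 : Fin 4), (3 : Fin 4)],
      ![(3 : Fin 4), (1 : Fin 4), (3 : Fin 4)],
      ![(3 : Fin 4), (2 : Fin 4), (3 : Fin 4)],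
      ![(3 : Fin 4), (3 : Fin 4), (3 : Fin 4)]]
  let U : Fin 17 → Fin 3 → ℤ := ![![180, 47820, 6060],
      ![210, 47880, 6000],
      ![300, 47880, 6000],
      ![435, 47865, 6030],
      ![780, 47730, 6150],
      ![1095, 47535, 6345],
      ![1440, 47520, 6360],
      ![2880, 47520, 6420],
      ![3114, 47478, 6456],
      ![4500, 46680, 7200],
      ![9480, 42360, 11520],
      ![41100, 16500, 37500],
      ![42360, 15480, 38640],
      ![42760, 15420, 39040],
      ![43020, 15435, 41580],
      ![43140, 15456, 42180],
      ![44580, 16800, 43620]]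
  have hv : ∀ i j l, V i j l = V j i l := by decide
  have hεs : ∀ i j l, E i j l = E j i l := by decide
  have hε : ∀ i j l, (E i j l).natAbs ≤ 1 := by decide
  have hθ : StrictMono Th := by rw [Fin.strictMono_iff_lt_succ]; decide
  have hsh : ∀ k, (∀ i, Sg k (Sg k i) = i ∧ Cl k (Sg k i) = Cl k i) ∨ (∀ i, Sg k i ≠ i) := by decide
  have hp : ∀ k i, E (Sg k i) i (Cl k i) ≠ 0 := by decide
  have ht : ∀ k i, U k (Sg k i) + U k i = 2 * (Th k * (D (Cl k i) : ℤ) - V (Sg k i) i (Cl k i)) := by decide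
  have htT : ∀ k i, U k ((Sg k)⁻¹ i) + U k i = 2 * (Th k * (D (Cl k ((Sg k)⁻¹ i)) : ℤ) - V ((Sg k)⁻¹ i) i (Cl k ((Sg k)⁻¹ i))) := by
    decide
  have hs : ∀ k a b l, E a b l ≠ 0 → ¬ (Sg k b = a ∧ Cl k b = l) → ¬ ((Sg k)⁻¹ b = a ∧ Cl k ((Sg k)⁻¹ b) = l) →
      2 * (Th k * (D l : ℤ) - V a b l) < U k a + U k b := by
    decide
  have hdom : ∀ k, IsOrbitDominant D V E (Th k) (Sg k, Cl k) := fun k =>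
    isOrbitDominant_of_scaledPotential D V E (Th k) (Sg k) (Cl k) 2 (by norm_num) (U k) (U k) (hsh k) (hp k) (ht k) (htT k) (hs k)
  have halt : ∀ k : Fin 16, termSign E ((fun k => (Sg k, Cl k)) k.castSucc) * termSign E ((fun k => (Sg k, Cl k)) k.succ) < 0 := by
    decide
  exact ⟨V, E, Th, fun k => (Sg k, Cl k), hv, hεs, hε, hθ, hdom, halt⟩

end SymmetricOrbitThreeFourFloor

open SymmetricOrbitThreeFourFloor

/-- **`T^orb_sym(3,4) ≥ 16`**: every `B` with `TropRootLawAtSymmOrb 3 4 B` satisfies `16 ≤ B` (the T2-TROP16 design on `(0,1,4,40)`).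
[from `exists_orbit_chain`] -/
theorem sixteen_le_of_tropRootLawAtSymmOrb {B : ℕ} (h : TropRootLawAtSymmOrb 3 4 B) : 16 ≤ B := by
  obtain ⟨v, ε, θ, p, hv, hεs, -, hθ, hdom, halt⟩ := exists_orbit_chain
  exact h ![0, 1, 4, 40] v ε hv hεs 16 θ p hθ hdom halt

/-- `¬ TropRootLawAtSymmOrb 3 4 15`. [from `sixteen_le_of_tropRootLawAtSymmOrb`] -/
theorem not_tropRootLawAtSymmOrb_three_four_fifteen : ¬ TropRootLawAtSymmOrb 3 4 15 :=
  fun h => absurd (sixteen_le_of_tropRootLawAtSymmOrb h) (by norm_num)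

/-- **The kernel window for the symmetric ORBIT-model `(3,4)` tropical row: `[16, 17]`** — `TropRootLawAtSymmOrb 3 4 17` holds (p502374) and
`TropRootLawAtSymmOrb 3 4 15` fails; the least admissible `B` is `16` or `17` (cell value: `16`, two codes; `TSymOrb34Le16` NOT asserted).
[p502374 + `exists_orbit_chain`] -/
theorem tropRootLawAtSymmOrb_three_four_window : TropRootLawAtSymmOrb 3 4 17 ∧ ¬ TropRootLawAtSymmOrb 3 4 15 :=
  ⟨tropRootLawAtSymmOrb_three_four_seventeen, not_tropRootLawAtSymmOrb_three_four_fifteen⟩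

end Summit.ValiantsHypothesis.ValiantsHypothesis.Theorems.KPlusLogSqLaw
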